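import Literature.MathematicalPhysics.QuantumFieldTheory.Balaban1983to89.B6SectAVectorModelV1
import Literature.MathematicalPhysics.QuantumFieldTheory.Balaban1983to89.TorusLimitAxioms

/-!
# `Balaban1983to89.B6TranslateV1` — T. Bałaban, *Propagators and renormalization transformations for lattice gauge theories. II*, Commun. Math.
# Phys. **96** (1984) 223–250 [Balaban1984PropagatorsII], Sect. A pp. 224–226 on the torus `T_η`: TRANSLATION COVARIANCE OF THE WHOLE V1
# MULTI-LEVEL CALCULUS — the block maps, the averages `Q′, Q, Q′_k, Q_k`, the nested family `Ω₁ ⊃ … ⊃ Ω_k` (2.1)–(2.3) and its index set `𝔅`,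
# the operators `∂, ∂*, Δ, Q, Q′, a, Q*` of (2.7)–(2.20), the projection **`R`** (2.10)–(2.12), **`Δ_a`** (2.19) and **`G = Δ_a⁻¹`** (2.22) all
# commute with the translation of `T_η` by a vector `v ∈ L^kℤ^{d}` once the domains are translated along (`Ω_j ↦ Ω_j − v`) — the transport
# module of ROUTE (A) of the B6 fold owner's programme for the genuine `k`-level Proposition 2.6 (B6-CLOSURE.md §5 item 13 addendum:
# «`B6TranslateV1` — translation covariance of the V1 side … deltaAE/GE/…/majorants transport»)

statement-level skeleton of published theorems with citation tags; proofs where landed; nothing here is a claim about the Yang–Mills mass gap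

PDF held: `paper:balaban1984-cmp96-propagators-rt-ii` (journal page = PDF page + 222); pp. 224–226 [PDF 2–4] ((2.1)–(2.22)) and p. 238 [PDF 16]
(*"We identify the boundary of □̃³ and we get a torus which will be denoted by T_□"*) re-read this generation; [Balaban1983RegularityDecay] p. 572
(*"a torus T_η which we identify with a rectangular parallelepiped in ηZ^d with periodic conditions"*) for the torus conventions.

CITATION HEADER (lean-in-tree rule) — WHAT IS REPRODUCED.  Phase-2 file of the `lit-balaban` typed skeleton (HOME `run/shared/lean/pub/lit-balaban/`), unit
`lit-balaban-r03` (B6 fold owner; r03 gen 20, literature-prover-lit-balaban-r03-g20-0), referee ref-4.  SKELETON rows **B6.Eq2.1** × **B6.Eq2.7** ×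
**B6.Eq2.10** × **B6.Eq2.19** × **B6.Eq2.22** (cells; decls of record untouched).  No statement of the paper is a translation-covariance claim; print
USES it tacitly on p. 238 («identify … with a torus T_□») and in every «by translation» of [Balaban1984PropagatorsI] p. 19 («x(c) … obtained by
translation of x by the bond c»).  WHY THIS FILE: the k-level Proposition 2.6 assembly (r03's `B6GlobalChartV1.prop26_2136_V1_of_2134_eq291` and its
(d5-b) twin) runs the member-of-a-cube machinery (`B6AgreeLapV1Chart`/`B6AgreeQaQV1Chart`/`B6IndexCorrV1`/`B6MemberOfCubeV1`: integer label
windows `[x₀, x₀ + N′)` of the fundamental box, no wrap-around) PER CUBE IN THE CUBE'S OWN CHART of the torus (p21's `TDomains.chart`, p38's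
`B6Partition118KLevelTorusCentral`), and must conjugate the resulting operator identities (`hagree`, `hinvl`, majorants) back to ONE global
lattice; this file supplies the conjugation on the V1 side.  IMPORTS BY NAME, restating nothing: `B6SectADomainsV1` (`Domains`, `LamSite/LamBond/
Deep/InOm/InGauge`), `B6SectAOperatorsV1` (`dE, dsE, dcE, dcsE, QE, QpE, aE, QsE, lapE, KE, RE`, `mem_ker_QpE_iff`), `B6SectAVectorModelV1`
(`deltaAE`, `GE`, `GE_deltaAE`, `deltaAE_GE`), `LatticeFieldCalculus` (`grad, diverg, curl, laplace, segSum, siteAvg, bondAvg, siteAvgIter,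
bondAvgIter`), `B5Eq118OneStroke` (`iterBlockOf`), `TorusGeometry` (`Site.blockSite`, `blockEquiv`, `blockOf_blockSite`), `TorusLimitAxioms`
(`Site.instAddCommGroup`, `Site.shift_add`, `PBond.translate(Equiv)`, `Plaq.translate(Equiv)` — the additive structure of `T^{(j)}` only; none of
that file's limit bookkeeping is used), Mathlib (`LinearIsometryEquiv.piLpCongrLeft`, `LinearMap.adjoint`, `Submodule.eq_starProjection_of_mem_orthogonal`).

## WHAT THIS FILE CERTIFIES (kernel-checked, 0 sorry, standard axioms; NO `def … : Prop`, no new named fact; definitions WITH BODIES: `tv`, `trS`,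
`trV`, `trP`, `trD`, `IsTr.idxB`, `IsTr.idxS`, `US`, `UB`, `UP`, `IsTr.UI`, `IsTr.UIs`; ONE `Prop`-valued STRUCTURE `IsTr D₁ D₂ v` = the hypothesis
shape «`Ω′` is the translate of `Ω` by `v`», inhabited by the model `isTr_trD`)

* §1 `tv P v n : Site P n` — the vector `v/L^n` of `T^{(n)}` for an integer vector `v`; **`blockSite_add_tv`** (offsets are kept), **`blockOf_add_tv`**
  (`blockOf (x + v/L^n) = blockOf x + v/L^{n+1}` for `L^{n+1} ∣ v`, standing range), **`iterBlockOf_add_tv`** (`B^n`-blocks go to `B^n`-blocks),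
  `unshift_add`, `runSite_add`, `translate_tgt`.
* §2 `trS/trV/trP` (`(τ_a f)(x) = f(x + a)` on sites ∕ bonds ∕ plaquettes, group laws) and the covariance of the lattice calculus: **`grad_trS`**,
  **`diverg_trV`**, **`curl_trV`**, **`laplace_trS`**, `segSum_trV`, **`siteAvg_trS`** / **`bondAvg_trV`** (one level, `L^{n+1} ∣ v`), **`siteAvgIter_trS`** /
  **`bondAvgIter_trV`** (`Q′_k(τ_v λ) = τ_{v/L^k}(Q′_kλ)`, `Q_k(τ_v A) = τ_{v/L^k}(Q_kA)` for `L^k ∣ v`, `k ≤ m + K`).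
* §3 **`IsTr D₁ D₂ v`** (same `k`, `L^k ∣ v`, `y ∈ Ω′_n ↔ y + v/L^n ∈ Ω_n`), the model **`trD D v hv : Domains P`** (`Ω_j − v`) with **`isTr_trD`**, and for
  every such pair: `IsTr.deep_iff`, **`IsTr.lamSite_iff`** / **`IsTr.lamBond_iff`** (the sets `Λ_n` of (2.3) correspond), `IsTr.inOm_iff`,
  **`IsTr.inGauge_iff`** (`N(Q′)` (2.7)/(2.10) corresponds).
* §4 **`IsTr.idxB`** / **`IsTr.idxS`**: `𝔅(Ω′) ≃ 𝔅(Ω)` (bonds ∕ sites), level by level (`Equiv.subtypeEquiv ∘ Equiv.sigmaCongr`).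
* §5 the translations as linear ISOMETRIES `US a` (`L²(T_η)`), `UB a`, `UP a`, `IsTr.UI`/`IsTr.UIs` (`L²(𝔅)`, reindexing along `idxB`/`idxS`); the generic
  **`adjoint_comm`** (`T′U = VT ⟹ T′*V = UT*`); and the COVARIANCE THEOREMS, as operator identities `Op(Ω′) ∘ U = U′ ∘ Op(Ω)` and pointwise:
  **`dE_comm`**, **`dsE_comm`**, **`dcE_comm`**, **`dcsE_comm`**, **`lapE_comm`** (any translation `a`), **`IsTr.QE_comm`**, **`IsTr.QpE_comm`**,
  **`IsTr.aE_comm`** (weights `w ∘ idxB`), **`IsTr.QsE_comm`**, **`IsTr.ker_QpE_map`** (`U N(Q′) = N(Q′)`), **`IsTr.KE_map`** (`U ΔN(Q′) = ΔN(Q′)`),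
  **`IsTr.RE_comm`** (THE ORTHOGONAL PROJECTION `R` OF (2.10)–(2.12) COMMUTES WITH THE TRANSLATION — by the characterisation of `starProjection`),
  **`IsTr.deltaAE_comm`/`deltaAE_UB`** (`Δ_a(Ω′, w ∘ idxB) U_v = U_v Δ_a(Ω, w)`) and **`IsTr.GE_comm`/`GE_UB`** (`G(Ω′, w ∘ idxB) U_v = U_v G(Ω, w)`);
  `IsTr.comp_idxB_symm` (every weight on `𝔅(Ω′)` is a pull-back, so the theorems cover `Δ_a(Ω′, w′)` for all `w′`).

## HONEST SCOPE / DIVERGENCES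

(1) Pure infrastructure: a dictionary, no estimate; the value is that the (d5-b) assembly may prove each cube's ring data in the cube's chart and
conjugate.  (2) Divisibility `L^k ∣ v` (`k` = the number of levels of the family) is what makes `Ω_j − v` a union of `j`-blocks for every `j ≤ k`;
the torus charts of p21 translate by `M_h·L^{k+1}·s`, which qualifies.  (3) The weights of the translated problem are the pulled-back ones
`w ∘ idxB` — a bookkeeping identity, not a restriction.  (4) Nothing here touches the distance (2.46), the cube covers or the majorants (p38's
`B6TorusDepthDistance.blkIsoT/distT_chart_eq` and the fold owner's next file do the geometric side).  Value = typed skeleton (transport lemmas) for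
the k-level Prop. 2.6 programme; NOT summit progress.
-/

noncomputable section

open scoped BigOperators
open Finset

namespace Literature.MathematicalPhysics.QuantumFieldTheory.Balaban1983to89.B6TranslateV1

open LatticeFieldCalculus
open B5Eq118OneStroke (iterBlockOf iterBlockOf_zero iterBlockOf_succ)

variable {P : Params}

/-! ## §1  The level-`n` translation vector `v/L^n` of an integer vector `v`; blocks go to blocks -/

section Vectors

/-- **THE TRANSLATION VECTOR OF `T^{(n)}`** induced by an integer vector `v` of the fine lattice divisible by `L^n`: `v/L^n`
(coordinatewise, read in `ℤ/N_n`).  [cite: Balaban1984PropagatorsII, (2.1) p.224 («Ω_j = B^j(Ω_j^{(j)})»), dictionary] -/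
def tv (P : Params) (v : Fin P.d → ℤ) (n : ℕ) : Site P n := fun μ => ((v μ / (P.L : ℤ) ^ n : ℤ) : ZMod (P.sitesPerDir n))

/-- coordinates of `tv`. [cite: Balaban1984PropagatorsII, (2.1) p.224, dictionary] -/
theorem tv_apply (v : Fin P.d → ℤ) (n : ℕ) (μ : Fin P.d) : tv P v n μ = ((v μ / (P.L : ℤ) ^ n : ℤ) : ZMod (P.sitesPerDir n)) := rfl

/-- at level `0` the vector is `v` itself. [cite: Balaban1984PropagatorsII, (2.1) p.224, dictionary] -/
theorem tv_zero_apply (v : Fin P.d → ℤ) (μ : Fin P.d) : tv P v 0 μ = ((v μ : ℤ) : ZMod (P.sitesPerDir 0)) := by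
  simp [tv]

/-- `tv` is additive in `v` on vectors divisible by `L^n`. [cite: Balaban1984PropagatorsII, (2.1) p.224, dictionary] -/
theorem tv_neg (v : Fin P.d → ℤ) (n : ℕ) (hv : ∀ μ, ((P.L : ℤ) ^ n) ∣ v μ) : tv P (-v) n = -tv P v n := by
  funext μ
  obtain ⟨q, hq⟩ := hv μ
  have hL0 : ((P.L : ℤ) ^ n) ≠ 0 := pow_ne_zero _ (by exact_mod_cast P.L_pos.ne')
  show (((-v) μ / (P.L : ℤ) ^ n : ℤ) : ZMod (P.sitesPerDir n)) = -(((v μ / (P.L : ℤ) ^ n : ℤ) : ZMod (P.sitesPerDir n)))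
  rw [Pi.neg_apply, hq, ← mul_neg, Int.mul_ediv_cancel_left _ hL0, Int.mul_ediv_cancel_left _ hL0, Int.cast_neg]

/-- `((y + q).val : ℤ) ≡ y.val + q (mod N)`. [folklore] -/
private theorem val_add_intCast_modEq {N : ℕ} [NeZero N] (y : ZMod N) (q : ℤ) :
    (((y + (q : ZMod N)).val : ℕ) : ℤ) ≡ ((y.val : ℕ) : ℤ) + q [ZMOD (N : ℤ)] := by
  have h : ((((y + (q : ZMod N)).val : ℕ) : ℤ) : ZMod N) = ((((y.val : ℕ) : ℤ) + q : ℤ) : ZMod N) := by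
    push_cast
    rw [ZMod.natCast_zmod_val, ZMod.natCast_zmod_val]
  exact (ZMod.intCast_eq_intCast_iff _ _ _).1 h

/-- **OFFSETS ARE KEPT**: translating the site of offset `r` in the block over `y` by `v/L^n` gives the site of offset `r` in the
block over `y + v/L^{n+1}` (`L^{n+1} ∣ v`, standing range). [cite: Balaban1984PropagatorsI, (1.6) p.18; Balaban1984PropagatorsII, (2.1) p.224, dictionary] -/
theorem blockSite_add_tv {n : ℕ} (hn : n + 1 ≤ P.m + P.K) {v : Fin P.d → ℤ} (hv : ∀ μ, ((P.L : ℤ) ^ (n + 1)) ∣ v μ)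
    (y : Site P (n + 1)) (r : Fin P.d → Fin P.L) :
    Site.blockSite y r + tv P v n = Site.blockSite (y + tv P v (n + 1)) r := by
  funext μ
  obtain ⟨q, hq⟩ := hv μ
  have hL0 : (P.L : ℤ) ≠ 0 := by exact_mod_cast P.L_pos.ne'
  have h1 : v μ / (P.L : ℤ) ^ n = P.L * q := by
    rw [hq, pow_succ, mul_assoc, Int.mul_ediv_cancel_left _ (pow_ne_zero _ hL0)]
  have h2 : v μ / (P.L : ℤ) ^ (n + 1) = q := by rw [hq, Int.mul_ediv_cancel_left _ (pow_ne_zero _ hL0)]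
  rw [Site.add_apply]
  simp only [Site.blockSite, tv_apply, h1, h2, Site.add_apply]
  rw [show ((((y μ).val * P.L + (r μ : ℕ) : ℕ)) : ZMod (P.sitesPerDir n)) + (((P.L : ℤ) * q : ℤ) : ZMod (P.sitesPerDir n)) =
      (((((y μ).val : ℕ) : ℤ) * P.L + (r μ : ℕ) + P.L * q : ℤ) : ZMod (P.sitesPerDir n)) by push_cast; ring,
    show ((((y μ + (q : ZMod (P.sitesPerDir (n + 1)))).val * P.L + (r μ : ℕ) : ℕ)) : ZMod (P.sitesPerDir n)) =
      (((((y μ + (q : ZMod (P.sitesPerDir (n + 1)))).val : ℕ) : ℤ) * P.L + (r μ : ℕ) : ℤ) : ZMod (P.sitesPerDir n)) by push_cast; ring,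
    ZMod.intCast_eq_intCast_iff_dvd_sub, P.sitesPerDir_eq_mul_succ hn]
  have key := (val_add_intCast_modEq (y μ) q).symm.dvd
  -- `N' ∣ (y.val + q) - (y + q).val`, hence `N'·L ∣ L·(…)`
  obtain ⟨c, hc⟩ := key
  refine ⟨c, ?_⟩
  push_cast
  linear_combination (P.L : ℤ) * hc

/-- **BLOCKS GO TO BLOCKS**: `blockOf (x + v/L^n) = blockOf x + v/L^{n+1}` for `L^{n+1} ∣ v` (standing range `n + 1 ≤ m + K`).
[cite: Balaban1984PropagatorsI, (1.6) p.18; Balaban1984PropagatorsII, (2.1) p.224, dictionary] -/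
theorem blockOf_add_tv {n : ℕ} (hn : n + 1 ≤ P.m + P.K) {v : Fin P.d → ℤ} (hv : ∀ μ, ((P.L : ℤ) ^ (n + 1)) ∣ v μ)
    (x : Site P n) : blockOf (x + tv P v n) = blockOf x + tv P v (n + 1) := by
  obtain ⟨r, hr⟩ : ∃ r : Fin P.d → Fin P.L, Site.blockSite (blockOf x) r = x :=
    ⟨Site.blockEquiv hn (blockOf x) ⟨x, rfl⟩, congrArg Subtype.val ((Site.blockEquiv hn (blockOf x)).left_inv ⟨x, rfl⟩)⟩
  conv_lhs => rw [← hr]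
  rw [blockSite_add_tv hn hv, Site.blockOf_blockSite hn]

/-- divisibility by a lower power. [folklore] -/
private theorem dvd_of_le {n n' : ℕ} (h : n ≤ n') {v : Fin P.d → ℤ} (hv : ∀ μ, ((P.L : ℤ) ^ n') ∣ v μ) (μ : Fin P.d) :
    ((P.L : ℤ) ^ n) ∣ v μ :=
  dvd_trans (pow_dvd_pow _ h) (hv μ)

/-- **`B^n`-BLOCKS GO TO `B^n`-BLOCKS**: `iterBlockOf n (x + v) = iterBlockOf n x + v/L^n` for `L^n ∣ v`, `n ≤ m + K`.
[cite: Balaban1984PropagatorsI, (1.18) p.20; Balaban1984PropagatorsII, (2.1) p.224, dictionary] -/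
theorem iterBlockOf_add_tv : ∀ (n : ℕ), n ≤ P.m + P.K → ∀ {v : Fin P.d → ℤ}, (∀ μ, ((P.L : ℤ) ^ n) ∣ v μ) →
    ∀ x : Site P 0, iterBlockOf n (x + tv P v 0) = iterBlockOf n x + tv P v n
  | 0, _, _, _, x => by simp
  | n + 1, hn, v, hv, x => by
    rw [iterBlockOf_succ, iterBlockOf_succ, iterBlockOf_add_tv n (by omega) (fun μ => dvd_of_le (Nat.le_succ n) hv μ) x,
      blockOf_add_tv hn hv]

/-- translation commutes with the unit step backwards. [cite: Balaban1983RegularityDecay, p.572 («a torus T_η … with periodic conditions»), dictionary] -/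
theorem unshift_add {n : ℕ} (x a : Site P n) (μ : Fin P.d) : (x + a).unshift μ = x.unshift μ + a := by
  funext ν
  rw [Site.add_apply]
  by_cases h : ν = μ
  · subst h
    simp only [Site.unshift, Function.update_self, Site.add_apply]
    abel
  · simp only [Site.unshift, Function.update_of_ne h, Site.add_apply]

/-- translation commutes with straight runs. [cite: Balaban1983RegularityDecay, p.572 («a torus T_η … with periodic conditions»), dictionary] -/
theorem runSite_add {n : ℕ} (x a : Site P n) (μ : Fin P.d) (t : ℕ) : runSite (x + a) μ t = runSite x μ t + a := by
  funext ν
  rw [Site.add_apply]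
  by_cases h : ν = μ
  · subst h
    simp only [runSite, Function.update_self, Site.add_apply]
    abel
  · simp only [runSite, Function.update_of_ne h, Site.add_apply]

/-- the end point of a translated bond. [cite: Balaban1983RegularityDecay, p.572 («a torus T_η … with periodic conditions»), dictionary] -/
theorem translate_tgt {n : ℕ} (a : Site P n) (b : PBond P n) : (b.translate a).tgt = b.tgt + a := by
  show (b.src + a).shift b.dir = b.src.shift b.dir + a
  exact Site.shift_add _ _ _

end Vectors

/-! ## §2  Translation of lattice FUNCTIONS and the covariance of `∂, ∂*, Δ`, straight contours and the block averages `Q′, Q, Q′_k, Q_k` -/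

section Functions

variable {n : ℕ} {V : Type*}

/-- **TRANSLATED SITE FUNCTION** `(τ_a f)(x) = f(x + a)`. [cite: Balaban1983RegularityDecay, p.572 («a torus T_η … with periodic conditions»), dictionary] -/
def trS (a : Site P n) (f : Site P n → V) : Site P n → V := fun x => f (x + a)

/-- **TRANSLATED BOND FUNCTION** `(τ_a A)(b) = A(b + a)`. [cite: Balaban1983RegularityDecay, p.572, dictionary] -/
def trV (a : Site P n) (A : PBond P n → V) : PBond P n → V := fun b => A (b.translate a)

/-- **TRANSLATED PLAQUETTE FUNCTION** `(τ_a F)(p) = F(p + a)`. [cite: Balaban1983RegularityDecay, p.572, dictionary] -/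
def trP (a : Site P n) (F : Plaq P n → V) : Plaq P n → V := fun p => F (Plaq.translate a p)

/-- unfolding `trS`. [cite: Balaban1983RegularityDecay, p.572 («a torus T_η … with periodic conditions»), dictionary] -/
@[simp] theorem trS_apply (a : Site P n) (f : Site P n → V) (x : Site P n) : trS a f x = f (x + a) := rfl

/-- unfolding `trV`. [cite: Balaban1983RegularityDecay, p.572 («a torus T_η … with periodic conditions»), dictionary] -/
@[simp] theorem trV_apply (a : Site P n) (A : PBond P n → V) (b : PBond P n) : trV a A b = A (b.translate a) := rfl

/-- unfolding `trP`. [cite: Balaban1983RegularityDecay, p.572 («a torus T_η … with periodic conditions»), dictionary] -/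
@[simp] theorem trP_apply (a : Site P n) (F : Plaq P n → V) (p : Plaq P n) : trP a F p = F (Plaq.translate a p) := rfl

/-- `τ_0 = id` (sites). [cite: Balaban1983RegularityDecay, p.572 («a torus T_η … with periodic conditions»), dictionary] -/
@[simp] theorem trS_zero (f : Site P n → V) : trS 0 f = f := by funext x; simp [trS]

/-- `τ_0 = id` (bonds). [cite: Balaban1983RegularityDecay, p.572 («a torus T_η … with periodic conditions»), dictionary] -/
@[simp] theorem trV_zero (A : PBond P n → V) : trV 0 A = A := by
  funext b; cases b; simp [trV, PBond.translate]

/-- `τ_a τ_{a′} = τ_{a′+a}` (sites). [cite: Balaban1983RegularityDecay, p.572 («a torus T_η … with periodic conditions»), dictionary] -/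
theorem trS_trS (a a' : Site P n) (f : Site P n → V) : trS a (trS a' f) = trS (a + a') f := by
  funext x; simp [trS, add_assoc]

/-- `τ_a τ_{a′} = τ_{a+a′}` (bonds). [cite: Balaban1983RegularityDecay, p.572 («a torus T_η … with periodic conditions»), dictionary] -/
theorem trV_trV (a a' : Site P n) (A : PBond P n → V) : trV a (trV a' A) = trV (a + a') A := by
  funext b; simp [trV, PBond.translate_translate]

/-- `τ_{-a} τ_a = id` (sites). [cite: Balaban1983RegularityDecay, p.572 («a torus T_η … with periodic conditions»), dictionary] -/
theorem trS_neg_trS (a : Site P n) (f : Site P n → V) : trS (-a) (trS a f) = f := by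
  rw [trS_trS, neg_add_cancel, trS_zero]

/-- `τ_a τ_{-a} = id` (sites). [cite: Balaban1983RegularityDecay, p.572 («a torus T_η … with periodic conditions»), dictionary] -/
theorem trS_trS_neg (a : Site P n) (f : Site P n → V) : trS a (trS (-a) f) = f := by
  rw [trS_trS, add_neg_cancel, trS_zero]

/-- `τ_{-a} τ_a = id` (bonds). [cite: Balaban1983RegularityDecay, p.572 («a torus T_η … with periodic conditions»), dictionary] -/
theorem trV_neg_trV (a : Site P n) (A : PBond P n → V) : trV (-a) (trV a A) = A := by
  rw [trV_trV, neg_add_cancel, trV_zero]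

/-- `τ_a τ_{-a} = id` (bonds). [cite: Balaban1983RegularityDecay, p.572 («a torus T_η … with periodic conditions»), dictionary] -/
theorem trV_trV_neg (a : Site P n) (A : PBond P n → V) : trV a (trV (-a) A) = A := by
  rw [trV_trV, add_neg_cancel, trV_zero]

variable [AddCommGroup V] [Module ℝ V]

/-- **`∂` IS TRANSLATION COVARIANT**: `∂(τ_a λ) = τ_a(∂λ)`. [cite: Balaban1984PropagatorsI, (1.4) p.18] -/
theorem grad_trS (c : ℝ) (a : Site P n) (f : Site P n → V) : grad c (trS a f) = trV a (grad c f) := by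
  funext b
  simp only [grad, trS_apply, trV_apply, translate_tgt, PBond.translate_src]

/-- **`∂*` IS TRANSLATION COVARIANT**: `∂*(τ_a A) = τ_a(∂*A)`. [cite: Balaban1984PropagatorsI, (1.21) p.21] -/
theorem diverg_trV (c : ℝ) (a : Site P n) (A : PBond P n → V) : diverg c (trV a A) = trS a (diverg c A) := by
  funext x
  simp only [diverg, trV_apply, trS_apply, PBond.translate, unshift_add]

/-- **THE PLAQUETTE VARIABLE IS TRANSLATION COVARIANT**: `∂(τ_a A) = τ_a(∂A)` on plaquettes. [cite: Balaban1984PropagatorsI, (1.2) p.18] -/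
theorem curl_trV (c : ℝ) (a : Site P n) (A : PBond P n → V) : curl c (trV a A) = trP a (curl c A) := by
  funext p
  simp only [curl, trV_apply, trP_apply, PBond.translate, Plaq.translate, Site.shift_add]

/-- **`Δ` IS TRANSLATION COVARIANT**: `Δ(τ_a f) = τ_a(Δf)`. [cite: Balaban1984PropagatorsI, (1.21) p.21] -/
theorem laplace_trS (c : ℝ) (a : Site P n) (f : Site P n → V) : laplace c (trS a f) = trS a (laplace c f) := by
  funext x
  simp only [laplace, trS_apply, Site.shift_add, unshift_add]

omit [Module ℝ V] in
/-- **STRAIGHT CONTOURS ARE TRANSLATION COVARIANT**: `(τ_a A)([x, x + n e_μ]) = A([x + a, x + a + n e_μ])`. [cite: Balaban1984PropagatorsI, (1.8) p.19] -/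
theorem segSum_trV (a : Site P n) (A : PBond P n → V) (x : Site P n) (μ : Fin P.d) (t : ℕ) :
    segSum (trV a A) x μ t = segSum A (x + a) μ t := by
  unfold segSum
  refine Finset.sum_congr rfl fun s _ => ?_
  simp only [trV_apply, runBond, PBond.translate, runSite_add]

/-- **`Q′` IS TRANSLATION COVARIANT ACROSS THE LEVELS**: `Q′(τ_{v/L^n} λ) = τ_{v/L^{n+1}}(Q′λ)` for `L^{n+1} ∣ v`.
[cite: Balaban1984PropagatorsI, (1.13) p.19; Balaban1983RegularityDecay, (1.1) p.572] -/
theorem siteAvg_trS (hn : n + 1 ≤ P.m + P.K) {v : Fin P.d → ℤ} (hv : ∀ μ, ((P.L : ℤ) ^ (n + 1)) ∣ v μ) (f : Site P n → V) :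
    siteAvg (trS (tv P v n) f) = trS (tv P v (n + 1)) (siteAvg f) := by
  funext y
  simp only [siteAvg, trS_apply, blockSite_add_tv hn hv]

/-- **`Q` IS TRANSLATION COVARIANT ACROSS THE LEVELS**: `Q(τ_{v/L^n} A) = τ_{v/L^{n+1}}(QA)` for `L^{n+1} ∣ v`.
[cite: Balaban1984PropagatorsI, (1.11) p.19] -/
theorem bondAvg_trV (hn : n + 1 ≤ P.m + P.K) {v : Fin P.d → ℤ} (hv : ∀ μ, ((P.L : ℤ) ^ (n + 1)) ∣ v μ) (A : PBond P n → V) :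
    bondAvg (trV (tv P v n) A) = trV (tv P v (n + 1)) (bondAvg A) := by
  funext c
  simp only [bondAvg, trV_apply, segSum_trV, blockSite_add_tv hn hv, PBond.translate]

end Functions

section Iterated

variable {V : Type*} [AddCommGroup V] [Module ℝ V]

/-- **`Q′_k` IS TRANSLATION COVARIANT**: `Q′_k(τ_v λ) = τ_{v/L^k}(Q′_kλ)` for `L^k ∣ v`, `k ≤ m + K`. [cite: Balaban1984PropagatorsI, (1.20) p.20] -/
theorem siteAvgIter_trS : ∀ (k : ℕ), k ≤ P.m + P.K → ∀ {v : Fin P.d → ℤ}, (∀ μ, ((P.L : ℤ) ^ k) ∣ v μ) →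
    ∀ f : Site P 0 → V, siteAvgIter k (trS (tv P v 0) f) = trS (tv P v k) (siteAvgIter k f)
  | 0, _, _, _, f => rfl
  | k + 1, hk, v, hv, f => by
    show siteAvg (siteAvgIter k (trS (tv P v 0) f)) = trS (tv P v (k + 1)) (siteAvg (siteAvgIter k f))
    rw [siteAvgIter_trS k (by omega) (fun μ => dvd_of_le (Nat.le_succ k) hv μ) f, siteAvg_trS hk hv]

/-- **`Q_k` IS TRANSLATION COVARIANT**: `Q_k(τ_v A) = τ_{v/L^k}(Q_kA)` for `L^k ∣ v`, `k ≤ m + K`. [cite: Balaban1984PropagatorsI, (1.18) p.20] -/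
theorem bondAvgIter_trV : ∀ (k : ℕ), k ≤ P.m + P.K → ∀ {v : Fin P.d → ℤ}, (∀ μ, ((P.L : ℤ) ^ k) ∣ v μ) →
    ∀ A : PBond P 0 → V, bondAvgIter k (trV (tv P v 0) A) = trV (tv P v k) (bondAvgIter k A)
  | 0, _, _, _, A => rfl
  | k + 1, hk, v, hv, A => by
    show bondAvg (bondAvgIter k (trV (tv P v 0) A)) = trV (tv P v (k + 1)) (bondAvg (bondAvgIter k A))
    rw [bondAvgIter_trV k (by omega) (fun μ => dvd_of_le (Nat.le_succ k) hv μ) A, bondAvg_trV hk hv]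

end Iterated

/-! ## §3  TRANSLATED NESTED FAMILIES: the relation `Ω′_j = Ω_j − v` (`IsTr`), the model `trD`, and the correspondence of `Λ_j` (sites and bonds),
`Ω_j` on fine sites, `N(Q′)` -/

section DomainsTr

open B6SectADomainsV1

/-- **`Ω′` IS THE TRANSLATE OF `Ω` BY `v`**: same number of levels, `L^k ∣ v`, and `y ∈ Ω′_n^{(n)} ↔ y + v/L^n ∈ Ω_n^{(n)}` at every level — the
relation between the nested family read in a translated chart of the torus and the original one (a `Prop`-valued STRUCTURE, i.e. a hypothesis
shape relating two data, not a named fact). [cite: Balaban1984PropagatorsII, (2.1)–(2.3) p.224, dictionary (translations of T_η)] -/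
structure IsTr (D₁ D₂ : Domains P) (v : Fin P.d → ℤ) : Prop where
  /-- same number of levels -/
  k_eq : D₂.k = D₁.k
  /-- `L^k ∣ v` -/
  dvd : ∀ μ, ((P.L : ℤ) ^ D₁.k) ∣ v μ
  /-- `y ∈ Ω′_n ↔ y + v/L^n ∈ Ω_n` -/
  mem_Om : ∀ (n : ℕ) (y : Site P n), y ∈ D₂.Om n ↔ y + tv P v n ∈ D₁.Om n

/-- **THE TRANSLATED NESTED FAMILY** `(Ω − v)_j^{(j)} := Ω_j^{(j)} − v/L^j` as a datum: again a nested family of block unions (blocks go to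
blocks, `blockOf_add_tv`), same number of levels; `L^k ∣ v`. [cite: Balaban1984PropagatorsII, (2.1)–(2.3) p.224, dictionary (translations of T_η)] -/
def trD (D : Domains P) (v : Fin P.d → ℤ) (hv : ∀ μ, ((P.L : ℤ) ^ D.k) ∣ v μ) : Domains P where
  k := D.k
  hk := D.hk
  Om n := (D.Om n).map (Equiv.addRight (tv P v n)).symm.toEmbedding
  Om_zero := by simp [D.Om_zero]
  Om_eq_empty n hn := by simp [D.Om_eq_empty hn]
  nested n y hy := by
    rw [Finset.mem_map_equiv, Equiv.symm_symm, Equiv.coe_addRight] at hy ⊢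
    change blockOf y + tv P v (n + 1) ∈ D.Om (n + 1) at hy
    change y + tv P v n ∈ D.Om n
    by_cases hn : n + 1 ≤ D.k
    · rw [← blockOf_add_tv (le_trans hn D.hk) (fun μ => dvd_of_le hn hv μ)] at hy
      exact D.nested _ hy
    · exfalso
      rw [D.Om_eq_empty (by omega)] at hy
      simp at hy

/-- same number of levels. [cite: Balaban1984PropagatorsII, (2.1) p.224, dictionary] -/
@[simp] theorem trD_k (D : Domains P) (v : Fin P.d → ℤ) (hv : ∀ μ, ((P.L : ℤ) ^ D.k) ∣ v μ) : (trD D v hv).k = D.k := rfl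

/-- **`trD D v` IS the translate of `D` by `v`** (the model of `IsTr`). [cite: Balaban1984PropagatorsII, (2.1) p.224, dictionary] -/
theorem isTr_trD (D : Domains P) (v : Fin P.d → ℤ) (hv : ∀ μ, ((P.L : ℤ) ^ D.k) ∣ v μ) : IsTr D (trD D v hv) v where
  k_eq := rfl
  dvd := hv
  mem_Om n y := by
    show y ∈ (D.Om n).map (Equiv.addRight (tv P v n)).symm.toEmbedding ↔ _
    rw [Finset.mem_map_equiv, Equiv.symm_symm, Equiv.coe_addRight]

variable {D₁ D₂ : Domains P} {v : Fin P.d → ℤ} (h : IsTr D₁ D₂ v)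
include h

/-- **`Deep` CORRESPONDS**: `y` inside `Ω′_{n+1}` iff `y + v/L^n` inside `Ω_{n+1}`. [cite: Balaban1984PropagatorsII, (2.3) p.224, dictionary] -/
theorem IsTr.deep_iff {n : ℕ} (y : Site P n) : D₂.Deep n y ↔ D₁.Deep n (y + tv P v n) := by
  unfold Domains.Deep
  rw [h.mem_Om]
  by_cases hn : n + 1 ≤ D₁.k
  · rw [blockOf_add_tv (le_trans hn D₁.hk) (fun μ => dvd_of_le hn h.dvd μ)]
  · rw [D₁.Om_eq_empty (by omega)]
    simp

/-- **`Λ_n` (SITES) CORRESPONDS**: `y ∈ Λ′_n ↔ y + v/L^n ∈ Λ_n`. [cite: Balaban1984PropagatorsII, (2.3) p.224, dictionary] -/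
theorem IsTr.lamSite_iff {n : ℕ} (y : Site P n) : D₂.LamSite n y ↔ D₁.LamSite n (y + tv P v n) := by
  unfold Domains.LamSite
  rw [h.mem_Om, h.deep_iff]

/-- **`Λ_n` (BONDS) CORRESPONDS**: `b ∈ Λ′_n ↔ b + v/L^n ∈ Λ_n`. [cite: Balaban1984PropagatorsII, (2.3) p.224 («Ω also the set of bonds»), dictionary] -/
theorem IsTr.lamBond_iff {n : ℕ} (b : PBond P n) : D₂.LamBond n b ↔ D₁.LamBond n (b.translate (tv P v n)) := by
  unfold Domains.LamBond
  rw [h.mem_Om, h.mem_Om, h.deep_iff, h.deep_iff, translate_tgt, PBond.translate_src]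

/-- **`Ω_n` ON FINE SITES CORRESPONDS**: `x ∈ Ω′_n ↔ x + v ∈ Ω_n` (`n ≤ k`). [cite: Balaban1984PropagatorsII, (2.2) p.224, dictionary] -/
theorem IsTr.inOm_iff {n : ℕ} (hn : n ≤ D₁.k) (x : Site P 0) : D₂.InOm n x ↔ D₁.InOm n (x + tv P v 0) := by
  unfold Domains.InOm
  rw [h.mem_Om, iterBlockOf_add_tv n (le_trans hn D₁.hk) (fun μ => dvd_of_le hn h.dvd μ)]

/-- **`N(Q′)` CORRESPONDS**: `τ_v λ ∈ N(Q′)(Ω′) ↔ λ ∈ N(Q′)(Ω)` ((2.7): the constraints `Q′_jλ = 0 on Λ_j` translate with the family).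
[cite: Balaban1984PropagatorsII, (2.7) p.224, (2.10) p.225] -/
theorem IsTr.inGauge_iff (lam : Site P 0 → ℝ) : D₂.InGauge (trS (tv P v 0) lam) ↔ D₁.InGauge lam := by
  unfold Domains.InGauge
  constructor
  · intro h' n y hy
    have hn : n ≤ D₁.k := D₁.le_of_lamSite hy
    have h'' := h' n (y - tv P v n) (by rw [h.lamSite_iff, sub_add_cancel]; exact hy)
    rwa [siteAvgIter_trS n (le_trans hn D₁.hk) (fun μ => dvd_of_le hn h.dvd μ), trS_apply, sub_add_cancel] at h''
  · intro h' n y hy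
    have hn : n ≤ D₁.k := by rw [← h.k_eq]; exact D₂.le_of_lamSite hy
    rw [siteAvgIter_trS n (le_trans hn D₁.hk) (fun μ => dvd_of_le hn h.dvd μ), trS_apply]
    exact h' n _ ((h.lamSite_iff y).1 hy)

end DomainsTr

/-! ## §4  The index sets `𝔅` of the two families are in bijection, level by level -/

section Index

open B6SectADomainsV1 B6SectAOperatorsV1

variable {D₁ D₂ : Domains P} {v : Fin P.d → ℤ} (h : IsTr D₁ D₂ v)
include h

/-- `b ∈ Λ_n ↔ b − v/L^n ∈ Λ′_n` (bonds). [cite: Balaban1984PropagatorsII, (2.3) p.224, dictionary] -/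
theorem IsTr.lamBond_iff_neg {n : ℕ} (b : PBond P n) : D₁.LamBond n b ↔ D₂.LamBond n (b.translate (-tv P v n)) := by
  rw [h.lamBond_iff, PBond.translate_translate, neg_add_cancel]
  cases b
  simp [PBond.translate]

/-- `y ∈ Λ_n ↔ y − v/L^n ∈ Λ′_n` (sites). [cite: Balaban1984PropagatorsII, (2.3) p.224, dictionary] -/
theorem IsTr.lamSite_iff_sub {n : ℕ} (y : Site P n) : D₁.LamSite n y ↔ D₂.LamSite n (y - tv P v n) := by
  rw [h.lamSite_iff, sub_add_cancel]

/-- **`𝔅(Ω′) ≃ 𝔅(Ω)` (BONDS)**: `(n, β) ↦ (n, β + v/L^n)`. [cite: Balaban1984PropagatorsII, (2.3) p.224 + (2.20) p.226, dictionary] -/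
def IsTr.idxB : BondIdx D₂ ≃ BondIdx D₁ :=
  Equiv.subtypeEquiv (Equiv.sigmaCongr (finCongr (by rw [h.k_eq])) fun n => PBond.translateEquiv (tv P v n))
    fun p => h.lamBond_iff p.2

/-- **`𝔅(Ω′) ≃ 𝔅(Ω)` (SITES)**: `(n, y) ↦ (n, y + v/L^n)`. [cite: Balaban1984PropagatorsII, (2.3) p.224 + (2.14) p.225, dictionary] -/
def IsTr.idxS : SiteIdx D₂ ≃ SiteIdx D₁ :=
  Equiv.subtypeEquiv (Equiv.sigmaCongr (finCongr (by rw [h.k_eq])) fun n => Equiv.addRight (tv P v n))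
    fun p => h.lamSite_iff p.2

/-- the level of the image. [cite: Balaban1984PropagatorsII, (2.3) p.224, dictionary] -/
@[simp] theorem IsTr.idxB_fst (i : BondIdx D₂) : ((h.idxB i).1.1 : ℕ) = i.1.1 := rfl

/-- the bond of the image. [cite: Balaban1984PropagatorsII, (2.3) p.224, dictionary] -/
@[simp] theorem IsTr.idxB_snd (i : BondIdx D₂) : (h.idxB i).1.2 = i.1.2.translate (tv P v i.1.1) := rfl

/-- the level of the image. [cite: Balaban1984PropagatorsII, (2.3) p.224, dictionary] -/
@[simp] theorem IsTr.idxS_fst (i : SiteIdx D₂) : ((h.idxS i).1.1 : ℕ) = i.1.1 := rfl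

/-- the site of the image. [cite: Balaban1984PropagatorsII, (2.3) p.224, dictionary] -/
@[simp] theorem IsTr.idxS_snd (i : SiteIdx D₂) : (h.idxS i).1.2 = i.1.2 + tv P v i.1.1 := rfl

end Index

/-! ## §5  The translations as isometries of `L²(T_η)`, `L²` of bonds ∕ plaquettes ∕ `𝔅`, and the covariance of the operators of Sect. A:
`∂, ∂*, Δ, Q, Q′, a, Q*`, `ΔN(Q′)`, **`R`**, **`Δ_a`** (2.19) and **`G = Δ_a⁻¹`** (2.22) -/

section L2

open scoped InnerProductSpace
open B6SectADomainsV1 B6SectAOperatorsV1 B6SectAVectorModelV1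
open BalabanImbrieJaffe1984to88.BIJ85AxialPropagator411 (BondSpace PlaqSpace)

/-- **TRANSLATION OF `L²(T_η)`** by `a`: `(U_a f)(x) = f(x + a)`, a linear isometry. [cite: Balaban1983RegularityDecay, p.572 («T_η … with periodic conditions»), dictionary] -/
def US (a : Site P 0) : ScalarSpace P ≃ₗᵢ[ℝ] ScalarSpace P := LinearIsometryEquiv.piLpCongrLeft 2 ℝ ℝ (Equiv.addRight a).symm

/-- **TRANSLATION OF `L²` OF BONDS** by `a`. [cite: Balaban1983RegularityDecay, p.572, dictionary] -/
def UB (a : Site P 0) : BondSpace P ≃ₗᵢ[ℝ] BondSpace P := LinearIsometryEquiv.piLpCongrLeft 2 ℝ ℝ (PBond.translateEquiv a).symm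

/-- **TRANSLATION OF `L²` OF PLAQUETTES** by `a`. [cite: Balaban1983RegularityDecay, p.572, dictionary] -/
def UP (a : Site P 0) : PlaqSpace P ≃ₗᵢ[ℝ] PlaqSpace P := LinearIsometryEquiv.piLpCongrLeft 2 ℝ ℝ (Plaq.translateEquiv a).symm

/-- `(U_a f)(x) = f(x + a)`. [cite: Balaban1983RegularityDecay, p.572 («a torus T_η … with periodic conditions»), dictionary] -/
@[simp] theorem US_apply (a : Site P 0) (f : ScalarSpace P) (x : Site P 0) : US a f x = f (x + a) := rfl

/-- `(U_a A)(b) = A(b + a)`. [cite: Balaban1983RegularityDecay, p.572 («a torus T_η … with periodic conditions»), dictionary] -/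
@[simp] theorem UB_apply (a : Site P 0) (A : BondSpace P) (b : PBond P 0) : UB a A b = A (b.translate a) := rfl

/-- `(U_a F)(p) = F(p + a)`. [cite: Balaban1983RegularityDecay, p.572 («a torus T_η … with periodic conditions»), dictionary] -/
@[simp] theorem UP_apply (a : Site P 0) (F : PlaqSpace P) (p : Plaq P 0) : UP a F p = F (Plaq.translate a p) := rfl

/-- the function of `U_a f` is `τ_a` of the function of `f`. [cite: Balaban1983RegularityDecay, p.572 («a torus T_η … with periodic conditions»), dictionary] -/
theorem ofLp_US (a : Site P 0) (f : ScalarSpace P) : WithLp.ofLp (US a f) = trS a (WithLp.ofLp f) := rfl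

/-- the function of `U_a A` is `τ_a` of the function of `A`. [cite: Balaban1983RegularityDecay, p.572 («a torus T_η … with periodic conditions»), dictionary] -/
theorem ofLp_UB (a : Site P 0) (A : BondSpace P) : WithLp.ofLp (UB a A) = trV a (WithLp.ofLp A) := rfl

/-- the function of `U_a F` is `τ_a` of the function of `F`. [cite: Balaban1983RegularityDecay, p.572 («a torus T_η … with periodic conditions»), dictionary] -/
theorem ofLp_UP (a : Site P 0) (F : PlaqSpace P) : WithLp.ofLp (UP a F) = trP a (WithLp.ofLp F) := rfl

/-- `U_a U_{-a} = 1` (sites). [cite: Balaban1983RegularityDecay, p.572 («a torus T_η … with periodic conditions»), dictionary] -/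
theorem US_US_neg (a : Site P 0) (f : ScalarSpace P) : US a (US (-a) f) = f := by
  ext x; simp [add_assoc]

/-- `U_a⁻¹ = U_{-a}` (sites). [cite: Balaban1983RegularityDecay, p.572 («a torus T_η … with periodic conditions»), dictionary] -/
theorem US_symm_apply (a : Site P 0) (f : ScalarSpace P) : (US a).symm f = US (-a) f :=
  (US a).injective (by rw [LinearIsometryEquiv.apply_symm_apply, US_US_neg])

/-- `U_a U_{-a} = 1` (bonds). [cite: Balaban1983RegularityDecay, p.572 («a torus T_η … with periodic conditions»), dictionary] -/
theorem UB_UB_neg (a : Site P 0) (A : BondSpace P) : UB a (UB (-a) A) = A := by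
  ext b; simp [PBond.translate]

/-- `U_a⁻¹ = U_{-a}` (bonds). [cite: Balaban1983RegularityDecay, p.572 («a torus T_η … with periodic conditions»), dictionary] -/
theorem UB_symm_apply (a : Site P 0) (A : BondSpace P) : (UB a).symm A = UB (-a) A :=
  (UB a).injective (by rw [LinearIsometryEquiv.apply_symm_apply, UB_UB_neg])

/-- **ADJOINTS OF COVARIANT OPERATORS ARE COVARIANT**: if `T′ U = V T` for isometries `U : E ≃ E′`, `V : F ≃ F′`, then `T′* V = U T*`. [cite: Balaban1984PropagatorsII, (2.19)–(2.20) p.226 («Q* is the adjoint operator»), dictionary] -/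
theorem adjoint_comm {E E' F F' : Type*} [NormedAddCommGroup E] [InnerProductSpace ℝ E] [FiniteDimensional ℝ E]
    [NormedAddCommGroup E'] [InnerProductSpace ℝ E'] [FiniteDimensional ℝ E']
    [NormedAddCommGroup F] [InnerProductSpace ℝ F] [FiniteDimensional ℝ F]
    [NormedAddCommGroup F'] [InnerProductSpace ℝ F'] [FiniteDimensional ℝ F']
    (U : E ≃ₗᵢ[ℝ] E') (V : F ≃ₗᵢ[ℝ] F') (T : E →ₗ[ℝ] F) (T' : E' →ₗ[ℝ] F')
    (hT : T' ∘ₗ U.toLinearEquiv.toLinearMap = V.toLinearEquiv.toLinearMap ∘ₗ T) :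
    LinearMap.adjoint T' ∘ₗ V.toLinearEquiv.toLinearMap = U.toLinearEquiv.toLinearMap ∘ₗ LinearMap.adjoint T := by
  apply LinearMap.ext; intro y
  apply ext_inner_right ℝ; intro x
  simp only [LinearMap.comp_apply, LinearEquiv.coe_coe, LinearIsometryEquiv.coe_toLinearEquiv]
  have hx : T' x = V (T (U.symm x)) := by
    have := LinearMap.congr_fun hT (U.symm x)
    simp only [LinearMap.comp_apply, LinearEquiv.coe_coe, LinearIsometryEquiv.coe_toLinearEquiv,
      LinearIsometryEquiv.apply_symm_apply] at this
    exact this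
  rw [LinearMap.adjoint_inner_left, hx, LinearIsometryEquiv.inner_map_map, ← LinearMap.adjoint_inner_left,
    ← U.inner_map_map, LinearIsometryEquiv.apply_symm_apply]

/-- **`∂` IS COVARIANT**: `∂ U_a = U_a ∂`. [cite: Balaban1984PropagatorsII, (2.8) p.224; Balaban1984PropagatorsI, (1.4) p.18] -/
theorem dE_comm (c : ℝ) (a : Site P 0) :
    dE (P := P) c ∘ₗ (US a).toLinearEquiv.toLinearMap = (UB a).toLinearEquiv.toLinearMap ∘ₗ dE c := by
  apply LinearMap.ext; intro f; apply PiLp.ext; intro b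
  simp only [LinearMap.comp_apply, LinearEquiv.coe_coe, LinearIsometryEquiv.coe_toLinearEquiv, dE_apply, ofLp_US,
    grad_trS, UB_apply, trV_apply]

/-- **`∂*` IS COVARIANT**: `∂* U_a = U_a ∂*`. [cite: Balaban1984PropagatorsII, (2.8) p.224; Balaban1984PropagatorsI, (1.21) p.21] -/
theorem dsE_comm (c : ℝ) (a : Site P 0) :
    dsE (P := P) c ∘ₗ (UB a).toLinearEquiv.toLinearMap = (US a).toLinearEquiv.toLinearMap ∘ₗ dsE c := by
  apply LinearMap.ext; intro A; apply PiLp.ext; intro x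
  simp only [LinearMap.comp_apply, LinearEquiv.coe_coe, LinearIsometryEquiv.coe_toLinearEquiv, dsE_apply, ofLp_UB,
    diverg_trV, US_apply, trS_apply]

/-- **`∂` ON VECTOR FIELDS IS COVARIANT**: `∂ U_a = U_a ∂` (plaquette variable). [cite: Balaban1984PropagatorsII, (2.5) p.224; Balaban1984PropagatorsI, (1.2) p.18] -/
theorem dcE_comm (c : ℝ) (a : Site P 0) :
    dcE (P := P) c ∘ₗ (UB a).toLinearEquiv.toLinearMap = (UP a).toLinearEquiv.toLinearMap ∘ₗ dcE c := by
  apply LinearMap.ext; intro A; apply PiLp.ext; intro p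
  simp only [LinearMap.comp_apply, LinearEquiv.coe_coe, LinearIsometryEquiv.coe_toLinearEquiv, dcE_apply, ofLp_UB,
    curl_trV, UP_apply, trP_apply]

/-- **`(∂ on vector fields)*` IS COVARIANT**. [cite: Balaban1984PropagatorsII, (2.19) p.226] -/
theorem dcsE_comm (c : ℝ) (a : Site P 0) :
    dcsE (P := P) c ∘ₗ (UP a).toLinearEquiv.toLinearMap = (UB a).toLinearEquiv.toLinearMap ∘ₗ dcsE c :=
  adjoint_comm (UB a) (UP a) (dcE c) (dcE c) (dcE_comm c a)

/-- **`Δ = ∂*∂` IS COVARIANT**. [cite: Balaban1984PropagatorsII, (2.8) p.224] -/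
theorem lapE_comm (c : ℝ) (a : Site P 0) :
    lapE (P := P) c ∘ₗ (US a).toLinearEquiv.toLinearMap = (US a).toLinearEquiv.toLinearMap ∘ₗ lapE c := by
  rw [lapE, LinearMap.comp_assoc, dE_comm, ← LinearMap.comp_assoc, dsE_comm, LinearMap.comp_assoc]

/-- pointwise `∂ U = U ∂`. [cite: Balaban1984PropagatorsII, (2.8) p.224] -/
theorem dE_US (c : ℝ) (a : Site P 0) (f : ScalarSpace P) : dE c (US a f) = UB a (dE c f) :=
  LinearMap.congr_fun (dE_comm (P := P) c a) f

/-- pointwise `∂* U = U ∂*`. [cite: Balaban1984PropagatorsII, (2.8) p.224] -/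
theorem dsE_UB (c : ℝ) (a : Site P 0) (A : BondSpace P) : dsE c (UB a A) = US a (dsE c A) :=
  LinearMap.congr_fun (dsE_comm (P := P) c a) A

/-- pointwise `∂ U = U ∂` on vector fields. [cite: Balaban1984PropagatorsII, (2.5) p.224] -/
theorem dcE_UB (c : ℝ) (a : Site P 0) (A : BondSpace P) : dcE c (UB a A) = UP a (dcE c A) :=
  LinearMap.congr_fun (dcE_comm (P := P) c a) A

/-- pointwise `∂* U = U ∂*` on plaquette functions. [cite: Balaban1984PropagatorsII, (2.19) p.226] -/
theorem dcsE_UP (c : ℝ) (a : Site P 0) (F : PlaqSpace P) : dcsE c (UP a F) = UB a (dcsE c F) :=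
  LinearMap.congr_fun (dcsE_comm (P := P) c a) F

/-- pointwise `Δ U = U Δ`. [cite: Balaban1984PropagatorsII, (2.8) p.224] -/
theorem lapE_US (c : ℝ) (a : Site P 0) (f : ScalarSpace P) : lapE c (US a f) = US a (lapE c f) :=
  LinearMap.congr_fun (lapE_comm (P := P) c a) f

variable {D₁ D₂ : Domains P} {v : Fin P.d → ℤ} (h : IsTr D₁ D₂ v)

/-- **THE REINDEXING `L²(𝔅(Ω)) → L²(𝔅(Ω′))`** (bonds): `(U ω)(n, β) = ω(n, β + v/L^n)`, an isometry. [cite: Balaban1984PropagatorsII, (2.20) p.226, dictionary] -/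
def IsTr.UI : BondIdxSpace D₁ ≃ₗᵢ[ℝ] BondIdxSpace D₂ := LinearIsometryEquiv.piLpCongrLeft 2 ℝ ℝ h.idxB.symm

/-- **THE REINDEXING `L²(𝔅(Ω)) → L²(𝔅(Ω′))`** (sites). [cite: Balaban1984PropagatorsII, (2.14) p.225, dictionary] -/
def IsTr.UIs : SiteIdxSpace D₁ ≃ₗᵢ[ℝ] SiteIdxSpace D₂ := LinearIsometryEquiv.piLpCongrLeft 2 ℝ ℝ h.idxS.symm

/-- `(U ω)(i) = ω(idxB i)`. [cite: Balaban1984PropagatorsII, (2.20) p.226, dictionary] -/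
@[simp] theorem IsTr.UI_apply (ω : BondIdxSpace D₁) (i : BondIdx D₂) : h.UI ω i = ω (h.idxB i) := rfl

/-- `(U ω)(i) = ω(idxS i)`. [cite: Balaban1984PropagatorsII, (2.14) p.225, dictionary] -/
@[simp] theorem IsTr.UIs_apply (ω : SiteIdxSpace D₁) (i : SiteIdx D₂) : h.UIs ω i = ω (h.idxS i) := rfl

include h

/-- **THE MULTI-SCALE `Q` (2.20) IS COVARIANT**: `Q_{Ω′} U_v = U Q_Ω` — the constraint functional `(Q_nA)(β)`, `β ∈ Λ_n(Ω′)`, of the translated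
configuration is the functional `(Q_nA)(β + v/L^n)`, `β + v/L^n ∈ Λ_n(Ω)`. [cite: Balaban1984PropagatorsII, (2.20) p.226, (2.6) p.224] -/
theorem IsTr.QE_comm : QE D₂ ∘ₗ (UB (tv P v 0)).toLinearEquiv.toLinearMap = h.UI.toLinearEquiv.toLinearMap ∘ₗ QE D₁ := by
  apply LinearMap.ext; intro A; apply PiLp.ext; intro i
  have hn : (i.1.1 : ℕ) ≤ D₁.k := by rw [← h.k_eq]; exact Nat.lt_succ_iff.mp i.1.1.isLt
  simp only [LinearMap.comp_apply, LinearEquiv.coe_coe, LinearIsometryEquiv.coe_toLinearEquiv, QE_apply, ofLp_UB,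
    bondAvgIter_trV _ (le_trans hn D₁.hk) (fun μ => dvd_of_le hn h.dvd μ), trV_apply, IsTr.UI_apply, IsTr.idxB_fst, IsTr.idxB_snd]

/-- **THE MULTI-SCALE `Q′` (2.14) IS COVARIANT**. [cite: Balaban1984PropagatorsII, (2.14) p.225, (2.7) p.224] -/
theorem IsTr.QpE_comm : QpE D₂ ∘ₗ (US (tv P v 0)).toLinearEquiv.toLinearMap = h.UIs.toLinearEquiv.toLinearMap ∘ₗ QpE D₁ := by
  apply LinearMap.ext; intro f; apply PiLp.ext; intro i
  have hn : (i.1.1 : ℕ) ≤ D₁.k := by rw [← h.k_eq]; exact Nat.lt_succ_iff.mp i.1.1.isLt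
  simp only [LinearMap.comp_apply, LinearEquiv.coe_coe, LinearIsometryEquiv.coe_toLinearEquiv, QpE_apply, ofLp_US,
    siteAvgIter_trS _ (le_trans hn D₁.hk) (fun μ => dvd_of_le hn h.dvd μ), trS_apply, IsTr.UIs_apply, IsTr.idxS_fst, IsTr.idxS_snd]

/-- **THE WEIGHTS `a` ARE COVARIANT** with the pulled-back weights `w ∘ idxB`. [cite: Balaban1984PropagatorsII, (2.18)–(2.20) p.226] -/
theorem IsTr.aE_comm (w : BondIdx D₁ → ℝ) :
    aE D₂ (w ∘ h.idxB) ∘ₗ h.UI.toLinearEquiv.toLinearMap = h.UI.toLinearEquiv.toLinearMap ∘ₗ aE D₁ w := by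
  apply LinearMap.ext; intro ω; apply PiLp.ext; intro i
  simp only [LinearMap.comp_apply, LinearEquiv.coe_coe, LinearIsometryEquiv.coe_toLinearEquiv, aE_apply, IsTr.UI_apply,
    Function.comp_apply]

/-- **`Q*` IS COVARIANT**. [cite: Balaban1984PropagatorsII, (2.19)–(2.20) p.226 («Q* is the adjoint operator»)] -/
theorem IsTr.QsE_comm : QsE D₂ ∘ₗ h.UI.toLinearEquiv.toLinearMap = (UB (tv P v 0)).toLinearEquiv.toLinearMap ∘ₗ QsE D₁ :=
  adjoint_comm (UB (tv P v 0)) h.UI (QE D₁) (QE D₂) h.QE_comm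

/-- pointwise `Q U = U Q`. [cite: Balaban1984PropagatorsII, (2.20) p.226] -/
theorem IsTr.QE_UB (A : BondSpace P) : QE D₂ (UB (tv P v 0) A) = h.UI (QE D₁ A) := LinearMap.congr_fun h.QE_comm A

/-- pointwise `a U = U a`. [cite: Balaban1984PropagatorsII, (2.20) p.226] -/
theorem IsTr.aE_UI (w : BondIdx D₁ → ℝ) (ω : BondIdxSpace D₁) : aE D₂ (w ∘ h.idxB) (h.UI ω) = h.UI (aE D₁ w ω) :=
  LinearMap.congr_fun (h.aE_comm w) ω

/-- pointwise `Q* U = U Q*`. [cite: Balaban1984PropagatorsII, (2.20) p.226] -/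
theorem IsTr.QsE_UI (ω : BondIdxSpace D₁) : QsE D₂ (h.UI ω) = UB (tv P v 0) (QsE D₁ ω) := LinearMap.congr_fun h.QsE_comm ω

/-- **`ker Q′` IS CARRIED ONTO `ker Q′`**: `U_v N(Q′)(Ω) = N(Q′)(Ω′)`. [cite: Balaban1984PropagatorsII, (2.10) p.225] -/
theorem IsTr.ker_QpE_map : (LinearMap.ker (QpE D₁)).map (US (tv P v 0)).toLinearEquiv.toLinearMap = LinearMap.ker (QpE D₂) := by
  ext f
  rw [Submodule.mem_map_equiv, mem_ker_QpE_iff, mem_ker_QpE_iff]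
  change D₁.InGauge (WithLp.ofLp ((US (tv P v 0)).symm f)) ↔ _
  rw [← h.inGauge_iff, US_symm_apply, ofLp_US, trS_trS_neg]

/-- **`ΔN(Q′)` IS CARRIED ONTO `ΔN(Q′)`**: `U_v ΔN(Q′)(Ω) = ΔN(Q′)(Ω′)`. [cite: Balaban1984PropagatorsII, (2.10) p.225] -/
theorem IsTr.KE_map (c : ℝ) : (KE D₁ c).map (US (tv P v 0)).toLinearEquiv.toLinearMap = KE D₂ c := by
  rw [KE, KE, ← Submodule.map_comp, ← lapE_comm, Submodule.map_comp, h.ker_QpE_map]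

/-- **`R` IS COVARIANT**: the orthogonal projection onto `ΔN(Q′)` commutes with the translation, `R_{Ω′} U_v = U_v R_Ω`.
[cite: Balaban1984PropagatorsII, (2.10)–(2.12) p.225] -/
theorem IsTr.RE_comm (c : ℝ) : RE D₂ c ∘ₗ (US (tv P v 0)).toLinearEquiv.toLinearMap = (US (tv P v 0)).toLinearEquiv.toLinearMap ∘ₗ RE D₁ c := by
  apply LinearMap.ext; intro f
  simp only [LinearMap.comp_apply, LinearEquiv.coe_coe, LinearIsometryEquiv.coe_toLinearEquiv, RE_apply]
  apply Submodule.eq_starProjection_of_mem_orthogonal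
  · rw [← h.KE_map]
    exact Submodule.mem_map_of_mem (RE_mem D₁ c f)
  · rw [Submodule.mem_orthogonal]
    intro u hu
    rw [← h.KE_map, Submodule.mem_map] at hu
    obtain ⟨u₀, hu₀, rfl⟩ := hu
    simp only [LinearEquiv.coe_coe, LinearIsometryEquiv.coe_toLinearEquiv]
    rw [← map_sub, LinearIsometryEquiv.inner_map_map, ← RE_apply]
    have h' := (KE D₁ c).sub_starProjection_mem_orthogonal f
    rw [Submodule.mem_orthogonal] at h'
    exact h' u₀ hu₀

/-- pointwise `R U = U R`. [cite: Balaban1984PropagatorsII, (2.12) p.225] -/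
theorem IsTr.RE_US (c : ℝ) (f : ScalarSpace P) : RE D₂ c (US (tv P v 0) f) = US (tv P v 0) (RE D₁ c f) :=
  LinearMap.congr_fun (h.RE_comm c) f

/-- **`Δ_a` (2.19) IS COVARIANT** (pointwise): `Δ_a(Ω′, w ∘ idxB)(U_v A) = U_v(Δ_a(Ω, w) A)` — the multi-level operator of the translated family with
the pulled-back weights is the conjugate of the original one. [cite: Balaban1984PropagatorsII, (2.19) p.226] -/
theorem IsTr.deltaAE_UB (c : ℝ) (w : BondIdx D₁ → ℝ) (A : BondSpace P) :
    deltaAE D₂ c (w ∘ h.idxB) (UB (tv P v 0) A) = UB (tv P v 0) (deltaAE D₁ c w A) := by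
  simp only [deltaAE, LinearMap.add_apply, LinearMap.comp_apply, map_add, dcE_UB, dcsE_UP, dsE_UB, h.RE_US, dE_US, h.QE_UB, h.aE_UI,
    h.QsE_UI]

/-- **`Δ_a` (2.19) IS COVARIANT** (operators): `Δ_a(Ω′, w ∘ idxB) U_v = U_v Δ_a(Ω, w)`. [cite: Balaban1984PropagatorsII, (2.19) p.226] -/
theorem IsTr.deltaAE_comm (c : ℝ) (w : BondIdx D₁ → ℝ) :
    deltaAE D₂ c (w ∘ h.idxB) ∘ₗ (UB (tv P v 0)).toLinearEquiv.toLinearMap = (UB (tv P v 0)).toLinearEquiv.toLinearMap ∘ₗ deltaAE D₁ c w :=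
  LinearMap.ext fun A => h.deltaAE_UB c w A

/-- the pulled-back weights are positive. [cite: Balaban1984PropagatorsII, (2.20) p.226, dictionary] -/
theorem IsTr.pos_comp_idxB {w : BondIdx D₁ → ℝ} (hw : ∀ i, 0 < w i) : ∀ i, 0 < (w ∘ h.idxB) i := fun _ => hw _

/-- **`G = Δ_a⁻¹` (2.22) IS COVARIANT** (pointwise): `G(Ω′, w ∘ idxB)(U_v u) = U_v(G(Ω, w) u)`. [cite: Balaban1984PropagatorsII, (2.22) p.226] -/
theorem IsTr.GE_UB {c : ℝ} (hc : c ≠ 0) {w : BondIdx D₁ → ℝ} (hw : ∀ i, 0 < w i) (u : BondSpace P) :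
    GE D₂ hc (h.pos_comp_idxB hw) (UB (tv P v 0) u) = UB (tv P v 0) (GE D₁ hc hw u) := by
  conv_lhs => rw [← deltaAE_GE D₁ hc hw u]
  rw [← h.deltaAE_UB, GE_deltaAE]

/-- **`G = Δ_a⁻¹` (2.22) IS COVARIANT** (operators): `G(Ω′, w ∘ idxB) U_v = U_v G(Ω, w)`. [cite: Balaban1984PropagatorsII, (2.22) p.226] -/
theorem IsTr.GE_comm {c : ℝ} (hc : c ≠ 0) {w : BondIdx D₁ → ℝ} (hw : ∀ i, 0 < w i) :
    GE D₂ hc (h.pos_comp_idxB hw) ∘ₗ (UB (tv P v 0)).toLinearEquiv.toLinearMap = (UB (tv P v 0)).toLinearEquiv.toLinearMap ∘ₗ GE D₁ hc hw :=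
  LinearMap.ext fun u => h.GE_UB hc hw u

/-- **ANY WEIGHTS ON `𝔅(Ω′)` ARE PULLED-BACK WEIGHTS**: `w′ = (w′ ∘ idxB⁻¹) ∘ idxB` — so the covariance theorems apply to `Δ_a(Ω′, w′)` for every `w′`.
[cite: Balaban1984PropagatorsII, (2.20) p.226, dictionary] -/
theorem IsTr.comp_idxB_symm (w' : BondIdx D₂ → ℝ) : (w' ∘ h.idxB.symm) ∘ h.idxB = w' := by
  funext i; simp

end L2

end Literature.MathematicalPhysics.QuantumFieldTheory.Balaban1983to89.B6TranslateV1

end
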